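import Mathlib.NumberTheory.ModularForms.EisensteinSeries.Basic
import Mathlib.NumberTheory.DirichletCharacter.Bounds
import Mathlib.NumberTheory.Modular
import Mathlib.NumberTheory.ModularForms.CongruenceSubgroups
import Mathlib.Analysis.SpecialFunctions.Pow.Deriv
import Mathlib.Analysis.Complex.LocallyUniformLimit
import HarnessLib

/-!
# Hecke's real-analytic Eisenstein series of weight one with character on `Γ₀(M)` in the
# half-plane of absolute convergence `Re s > 1/2`

Topic `Literature/NumberTheory/EllipticCurves`; namespace
`Literature.NumberTheory.EllipticCurves.ModularForms`. Definitions with bodies (`e1Base`, `e1Term`,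
`eisensteinOne`, the index equivalence `gamma0RowsEquiv`) and theorems; no named fact.

For `M ≥ 1`, a Dirichlet character `χ` modulo `M` and `s ∈ ℂ`, Hecke's Eisenstein series of weight
one "of type `(1, χ)` at the cusp `∞` of `Γ₀(M)`" is

  `E₁,χ(z, s) = Σ_{(c,d) = 1, M ∣ c} χ(d) (cz + d)⁻¹ (Im z/|cz + d|²)ˢ
             = Σ_{γ ∈ Γ∞⁺\Γ₀(M)} χ(d_γ) j(γ, z)⁻¹ (Im γz)ˢ`                       (`eisensteinOne`)

(Hecke 1927, §2; Shimura, *Introduction to the arithmetic theory of automorphic functions*, §3.5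
and *Elementary Dirichlet series and modular forms*, §9; Miyake, *Modular Forms*, §7.2 with
`k = 1`; Gross 1987, §4), the sum running over the tree's index type
`{v = (c, d) : (c, d) = 1, M ∣ c}` of `Gamma0RankinSelbergUnfolding.lean` (bottom rows of
`Γ₀(M)` modulo `Γ∞⁺ = {Tⁿ}`), so that it plugs directly into the (signed) Rankin–Selberg unfolding
there. This file proves what holds BEFORE Hecke's analytic continuation:

* `summable_e1Term` — **absolute convergence for `Re s > 1/2`**: the terms are
  `O(yˢ r(z)^{-1-2σ} ‖(c,d)‖^{-1-2σ})`, `σ = Re s` (Mathlib's `EisensteinSeries.summand_bound` with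
  the real exponent `1 + 2σ > 2` and `summable_one_div_norm_rpow`);
* `eisensteinOne_smul` — **weight-one automorphy with character**: for `A = (a b; c d) ∈ Γ₀(M)` and
  every `s`, `χ(d) · E₁,χ(Az, s) = (cz + d) · E₁,χ(z, s)` (re-indexing `v ↦ vA`, which permutes the
  index set, `gamma0RowsEquiv`; `v(Az) = (vA)(z)/j(A, z)`, `Im Az/|v(Az)|² = Im z/|(vA) z|²`, and
  `χ((vA)₂) = χ(d) χ(v₂)` as `M ∣ v₁`);
* `e1Term_eq_of_row` — the summand is `χ(d) j(γ_v, z)⁻¹ (Im γ_v z)ˢ` for any `γ_v ∈ SL(2, ℤ)` with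
  bottom row `v` (the shape used by the unfolding);
* `continuous_eisensteinOne` — continuity in `z` (locally uniform convergence on vertical boxes);
* `differentiableAt_eisensteinOne` — **holomorphy in `s` on `Re s > 1/2`** (termwise
  `s ↦ χ(d)(cz+d)⁻¹ bˢ` is entire, and the series converges locally uniformly in `s`: on
  `a < Re s < b` the terms are bounded by the sum of the majorants at `a` and at `b`).

Deliberately NOT here (the next bricks of Hecke's theory): the Fourier expansion in `Re z`, the
continuation to `s = 0` ("Hecke's trick") and the holomorphic weight-one Eisenstein series
`E₁,χ(z, 0)` with its `q`-expansion `Σ σ_χ(n) qⁿ`, and the Eisenstein series at the other cusps.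

## References

* E. Hecke, *Theorie der Eisensteinschen Reihen höherer Stufe und ihre Anwendung auf
  Funktionentheorie und Arithmetik*, Abh. Math. Sem. Hamburg 5 (1927), 199–224, §2.
* T. Miyake, *Modular Forms*, Springer (1989), §7.2.
* G. Shimura, *Elementary Dirichlet Series and Modular Forms*, Springer (2007), §9.
* B. H. Gross, *Heights and the special values of L-series*, CMS Conf. Proc. 7 (1987), §4.
-/

noncomputable section

open Complex UpperHalfPlane EisensteinSeries ModularGroup CongruenceSubgroup Filter Matrix
  Matrix.SpecialLinearGroup
open scoped MatrixGroups Topology Real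

namespace Literature.NumberTheory.EllipticCurves.ModularForms

/-- The integer matrix of an element of `SL(2, ℤ)` (Mathlib's local notation). -/
local notation:1024 "↑ₘ" A:1024 => ((A : SL(2, ℤ)) : Matrix (Fin 2) (Fin 2) ℤ)

/-! ### The index set: coprime bottom rows `(c, d)` with `M ∣ c` -/

section Rows

variable (M : ℕ)

/-- `cz + d ≠ 0` for a coprime row `(c, d)`. [folklore] -/
theorem linear_ne_zero_of_isCoprime {v : Fin 2 → ℤ} (hv : IsCoprime (v 0) (v 1)) (z : ℍ) :
    (v 0 : ℂ) * z + v 1 ≠ 0 := by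
  have hne : (fun i => (v i : ℝ)) ≠ 0 := by
    intro h
    have h0 : (v 0 : ℝ) = 0 := congrFun h 0
    have h1 : (v 1 : ℝ) = 0 := congrFun h 1
    norm_cast at h0 h1
    rw [h0, h1] at hv
    exact not_isCoprime_zero_zero hv
  have := UpperHalfPlane.linear_ne_zero z hne
  simpa using this

/-- The entries of `v A` for a row `v` and `A ∈ SL(2, ℤ)`. [folklore] -/
theorem vecMul_SL_apply (v : Fin 2 → ℤ) (A : SL(2, ℤ)) (j : Fin 2) :
    (v ᵥ* ↑ₘA) j = v 0 * A 0 j + v 1 * A 1 j := by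
  simp [Matrix.vecMul, dotProduct, Fin.sum_univ_two]

/-- Right multiplication by `A ∈ SL(2, ℤ)` preserves coprimality of rows. [folklore] -/
theorem isCoprime_vecMul_SL {v : Fin 2 → ℤ} (hv : IsCoprime (v 0) (v 1)) (A : SL(2, ℤ)) :
    IsCoprime ((v ᵥ* ↑ₘA) 0) ((v ᵥ* ↑ₘA) 1) := by
  have hv' : v ∈ gammaSet 1 1 0 := (mem_gammaSet_one v).mpr hv
  have h := vecMul_SL2_mem_gammaSet hv' A
  rw [gammaSet_one_const 1 _ 0, mem_gammaSet_one] at h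
  exact h

/-- Right multiplication by `A ∈ Γ₀(M)` preserves `M ∣ c`. [folklore] -/
theorem dvd_vecMul_SL_zero {v : Fin 2 → ℤ} (hv : (M : ℤ) ∣ v 0) {A : SL(2, ℤ)} (hA : A ∈ Gamma0 M) :
    (M : ℤ) ∣ (v ᵥ* ↑ₘA) 0 := by
  rw [vecMul_SL_apply]
  have hc : (M : ℤ) ∣ A 1 0 := by
    have h := Gamma0_mem.mp hA
    exact (ZMod.intCast_zmod_eq_zero_iff_dvd _ _).mp h
  exact dvd_add (dvd_mul_of_dvd_left hv _) (dvd_mul_of_dvd_right hc _)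

/-- **`v ↦ vA` permutes the index set `{(c, d) = 1, M ∣ c}` for `A ∈ Γ₀(M)`** (inverse `v ↦ vA⁻¹`).
[folklore] -/
def gamma0RowsEquiv {A : SL(2, ℤ)} (hA : A ∈ Gamma0 M) :
    {v : Fin 2 → ℤ // IsCoprime (v 0) (v 1) ∧ (M : ℤ) ∣ v 0} ≃
      {v : Fin 2 → ℤ // IsCoprime (v 0) (v 1) ∧ (M : ℤ) ∣ v 0} where
  toFun v := ⟨v.1 ᵥ* ↑ₘA,
    isCoprime_vecMul_SL v.2.1 A, dvd_vecMul_SL_zero M v.2.2 hA⟩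
  invFun v := ⟨v.1 ᵥ* ↑ₘ(A⁻¹), isCoprime_vecMul_SL v.2.1 A⁻¹,
    dvd_vecMul_SL_zero M v.2.2 ((Gamma0 M).inv_mem hA)⟩
  left_inv v := by
    apply Subtype.ext
    change v.1 ᵥ* ↑ₘA ᵥ* ↑ₘ(A⁻¹) = v.1
    simp_rw [vecMul_vecMul, ← Matrix.SpecialLinearGroup.coe_mul, mul_inv_cancel,
      Matrix.SpecialLinearGroup.coe_one, vecMul_one]
  right_inv v := by
    apply Subtype.ext
    change v.1 ᵥ* ↑ₘ(A⁻¹) ᵥ* ↑ₘA = v.1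
    simp_rw [vecMul_vecMul, ← Matrix.SpecialLinearGroup.coe_mul, inv_mul_cancel,
      Matrix.SpecialLinearGroup.coe_one, vecMul_one]

/-- The underlying row of `gamma0RowsEquiv hA v` is `vA`. [folklore] -/
@[simp] theorem coe_gamma0RowsEquiv {A : SL(2, ℤ)} (hA : A ∈ Gamma0 M)
    (v : {v : Fin 2 → ℤ // IsCoprime (v 0) (v 1) ∧ (M : ℤ) ∣ v 0}) :
    ((gamma0RowsEquiv M hA v : {v : Fin 2 → ℤ // IsCoprime (v 0) (v 1) ∧ (M : ℤ) ∣ v 0}) :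
      Fin 2 → ℤ) = v.1 ᵥ* ↑ₘA := rfl

end Rows

/-! ### The summand and the series -/

section Series

variable {M : ℕ} (χ : DirichletCharacter ℂ M)

/-- The base `Im z / |cz + d|² = Im(γ_{(c,d)} z)` of the power, for a row `v = (c, d)`.
[folklore] -/
def e1Base (v : Fin 2 → ℤ) (z : ℍ) : ℝ := z.im / ‖(v 0 : ℂ) * z + v 1‖ ^ 2

/-- The summand `χ(d) (cz + d)⁻¹ (Im z/|cz + d|²)ˢ` of Hecke's weight-one Eisenstein series with
character. [folklore] -/
def e1Term (s : ℂ) (v : Fin 2 → ℤ) (z : ℍ) : ℂ :=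
  χ (v 1) * ((v 0 : ℂ) * z + v 1)⁻¹ * (((e1Base v z : ℝ)) : ℂ) ^ s

/-- **Hecke's real-analytic Eisenstein series of weight one and character `χ` on `Γ₀(M)`** (at the
cusp `∞`), `E₁,χ(z, s) = Σ_{(c,d)=1, M∣c} χ(d) (cz+d)⁻¹ (Im z/|cz+d|²)ˢ`, as a sum over the bottom
rows of `Γ₀(M)` modulo `Γ∞⁺`; absolutely convergent for `Re s > 1/2` (`summable_e1Term`), defined as
a `tsum` for every `s` (Hecke 1927, §2; Miyake §7.2, `k = 1`). [folklore] -/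
def eisensteinOne (z : ℍ) (s : ℂ) : ℂ :=
  ∑' v : {v : Fin 2 → ℤ // IsCoprime (v 0) (v 1) ∧ (M : ℤ) ∣ v 0}, e1Term χ s v z

/-- The base is positive for a coprime row. [folklore] -/
theorem e1Base_pos {v : Fin 2 → ℤ} (hv : IsCoprime (v 0) (v 1)) (z : ℍ) : 0 < e1Base v z :=
  div_pos z.im_pos (pow_pos (norm_pos_iff.mpr (linear_ne_zero_of_isCoprime hv z)) 2)

/-- `‖χ(d)(cz+d)⁻¹ bˢ‖ ≤ |cz+d|⁻¹ b^{Re s}` (`|χ| ≤ 1`). [folklore] -/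
theorem norm_e1Term_le {v : Fin 2 → ℤ} (hv : IsCoprime (v 0) (v 1)) (s : ℂ) (z : ℍ) :
    ‖e1Term χ s v z‖ ≤ ‖(v 0 : ℂ) * z + v 1‖⁻¹ * (e1Base v z) ^ s.re := by
  unfold e1Term
  rw [norm_mul, norm_mul, norm_inv, Complex.norm_cpow_eq_rpow_re_of_pos (e1Base_pos hv z)]
  have h1 : ‖χ (v 1)‖ ≤ 1 := DirichletCharacter.norm_le_one χ _
  have h2 : 0 ≤ ‖(v 0 : ℂ) * z + v 1‖⁻¹ * e1Base v z ^ s.re :=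
    mul_nonneg (inv_nonneg.mpr (norm_nonneg _)) (Real.rpow_nonneg (e1Base_pos hv z).le _)
  calc ‖χ (v 1)‖ * ‖(v 0 : ℂ) * z + v 1‖⁻¹ * e1Base v z ^ s.re
      = ‖χ (v 1)‖ * (‖(v 0 : ℂ) * z + v 1‖⁻¹ * e1Base v z ^ s.re) := by ring
    _ ≤ 1 * (‖(v 0 : ℂ) * z + v 1‖⁻¹ * e1Base v z ^ s.re) := mul_le_mul_of_nonneg_right h1 h2
    _ = ‖(v 0 : ℂ) * z + v 1‖⁻¹ * e1Base v z ^ s.re := one_mul _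

/-- `|cz+d|⁻¹ (Im z/|cz+d|²)^σ = (Im z)^σ |cz+d|^{-(1+2σ)}`. [folklore] -/
theorem inv_mul_e1Base_rpow {v : Fin 2 → ℤ} (hv : IsCoprime (v 0) (v 1)) (σ : ℝ) (z : ℍ) :
    ‖(v 0 : ℂ) * z + v 1‖⁻¹ * (e1Base v z) ^ σ =
      z.im ^ σ * ‖(v 0 : ℂ) * z + v 1‖ ^ (-(1 + 2 * σ)) := by
  have hL : 0 < ‖(v 0 : ℂ) * z + v 1‖ := norm_pos_iff.mpr (linear_ne_zero_of_isCoprime hv z)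
  have h2 : (‖(v 0 : ℂ) * z + v 1‖ ^ 2) ^ σ = ‖(v 0 : ℂ) * z + v 1‖ ^ (2 * σ) := by
    rw [← Real.rpow_natCast, ← Real.rpow_mul hL.le]
    norm_num
  unfold e1Base
  rw [Real.div_rpow z.im_pos.le (by positivity), h2,
    show -(1 + 2 * σ) = (-1) + (-(2 * σ)) by ring, Real.rpow_add hL, Real.rpow_neg hL.le (2 * σ),
    Real.rpow_neg_one, div_eq_mul_inv]
  ring

/-- **The summand bound**:
`‖χ(d)(cz+d)⁻¹(Im z/|cz+d|²)ˢ‖ ≤ (Im z)^σ r(z)^{-(1+2σ)} ‖(c,d)‖^{-(1+2σ)}` for `σ = Re s ≥ -1/2`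
(`EisensteinSeries.summand_bound` with the real exponent `1 + 2σ`). [folklore] -/
theorem norm_e1Term_le_majorant {v : Fin 2 → ℤ} (hv : IsCoprime (v 0) (v 1)) {s : ℂ}
    (hs : -1 / 2 ≤ s.re) (z : ℍ) :
    ‖e1Term χ s v z‖ ≤ z.im ^ s.re * (r z ^ (-(1 + 2 * s.re)) * ‖v‖ ^ (-(1 + 2 * s.re))) := by
  refine (norm_e1Term_le χ hv s z).trans ?_
  rw [inv_mul_e1Base_rpow hv]
  refine mul_le_mul_of_nonneg_left ?_ (by positivity)
  exact summand_bound z (k := 1 + 2 * s.re) (by linarith) v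

/-- Summability of the majorant `‖(c, d)‖^{-(1+2σ)}` over the index set for `σ > 1/2`. [folklore] -/
theorem summable_majorant_rows {σ : ℝ} (hσ : 1 / 2 < σ) :
    Summable fun v : {v : Fin 2 → ℤ // IsCoprime (v 0) (v 1) ∧ (M : ℤ) ∣ v 0} =>
      ‖(v : Fin 2 → ℤ)‖ ^ (-(1 + 2 * σ)) :=
  (summable_one_div_norm_rpow (k := 1 + 2 * σ) (by linarith)).subtype _

/-- **Absolute convergence of `E₁,χ(z, s)` for `Re s > 1/2`** (Hecke 1927, §2; Miyake §7.2 —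
the weight-`k` series converges absolutely for `k + 2 Re s > 2`). [folklore] -/
theorem summable_e1Term {s : ℂ} (hs : 1 / 2 < s.re) (z : ℍ) :
    Summable fun v : {v : Fin 2 → ℤ // IsCoprime (v 0) (v 1) ∧ (M : ℤ) ∣ v 0} =>
      e1Term χ s v z := by
  refine Summable.of_norm_bounded
    ((summable_majorant_rows hs).mul_left (z.im ^ s.re * r z ^ (-(1 + 2 * s.re)))) fun v => ?_
  have := norm_e1Term_le_majorant χ v.2.1 (s := s) (by linarith) z
  simpa [mul_assoc] using this

/-- The same, for the norms. [folklore] -/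
theorem summable_norm_e1Term {s : ℂ} (hs : 1 / 2 < s.re) (z : ℍ) :
    Summable fun v : {v : Fin 2 → ℤ // IsCoprime (v 0) (v 1) ∧ (M : ℤ) ∣ v 0} =>
      ‖e1Term χ s v z‖ := by
  refine Summable.of_nonneg_of_le (fun _ ↦ norm_nonneg _) (fun v ↦ ?_)
    ((summable_majorant_rows hs).mul_left (z.im ^ s.re * r z ^ (-(1 + 2 * s.re))))
  have := norm_e1Term_le_majorant χ v.2.1 (s := s) (by linarith) z
  simpa [mul_assoc] using this

/-! ### Weight-one automorphy with character under `Γ₀(M)` -/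

/-- `v(Az) = (vA)(z)/j(A, z)` for a coprime row `v` and `A ∈ SL(2, ℤ)`
(`EisensteinSeries.eisSummand_SL2_apply` in weight one). [folklore] -/
theorem linear_smul_eq_div {v : Fin 2 → ℤ} (hv : IsCoprime (v 0) (v 1)) (A : SL(2, ℤ)) (z : ℍ) :
    (v 0 : ℂ) * (A • z : ℍ) + v 1 =
      (((v ᵥ* ↑ₘA) 0 : ℂ) * z + (v ᵥ* ↑ₘA) 1) /
        denom A z := by
  have h := eisSummand_SL2_apply 1 v A z
  simp only [eisSummand, zpow_neg, zpow_one] at h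
  have hD : denom A z ≠ 0 := denom_ne_zero A z
  have hvA := isCoprime_vecMul_SL hv A
  have hL : ((v ᵥ* ↑ₘA) 0 : ℂ) * z + (v ᵥ* ↑ₘA) 1
      ≠ 0 := linear_ne_zero_of_isCoprime hvA z
  have hL0 : (v 0 : ℂ) * (A • z : ℍ) + v 1 ≠ 0 := linear_ne_zero_of_isCoprime hv (A • z)
  rw [inv_eq_iff_eq_inv, mul_inv, inv_inv] at h
  rw [h]
  field_simp

/-- `Im(Az)/|v(Az)|² = Im z/|(vA) z|²`. [folklore] -/
theorem e1Base_smul {v : Fin 2 → ℤ} (hv : IsCoprime (v 0) (v 1)) (A : SL(2, ℤ)) (z : ℍ) :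
    e1Base v (A • z) = e1Base (v ᵥ* ↑ₘA) z := by
  unfold e1Base
  have hD : denom A z ≠ 0 := denom_ne_zero A z
  have hDn : 0 < ‖denom A z‖ := norm_pos_iff.mpr hD
  rw [linear_smul_eq_div hv A z, ModularGroup.im_smul_eq_div_normSq A z, norm_div, div_pow,
    Complex.normSq_eq_norm_sq]
  have hL : 0 < ‖((v ᵥ* ↑ₘA) 0 : ℂ) * z +
      (v ᵥ* ↑ₘA) 1‖ :=
    norm_pos_iff.mpr (linear_ne_zero_of_isCoprime (isCoprime_vecMul_SL hv A) z)
  field_simp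

/-- `χ((vA)₂) = χ(v₂) χ(d)` for `A = (a b; c d)` when `M ∣ v₁` (as `(vA)₂ = v₁ b + v₂ d`).
[folklore] -/
theorem chi_vecMul_SL_one {v : Fin 2 → ℤ} (hv : (M : ℤ) ∣ v 0) (A : SL(2, ℤ)) :
    χ ((v ᵥ* ↑ₘA) 1) = χ (v 1) * χ (A 1 1) := by
  rw [vecMul_SL_apply]
  have h0 : ((v 0 * A 0 1 : ℤ) : ZMod M) = 0 := by
    rw [Int.cast_mul, (ZMod.intCast_zmod_eq_zero_iff_dvd _ _).mpr hv, zero_mul]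
  push_cast
  rw [show ((v 0 : ZMod M) * (A 0 1 : ZMod M)) = ((v 0 * A 0 1 : ℤ) : ZMod M) by push_cast; rfl,
    h0, zero_add, map_mul]

/-- **The summands are permuted up to the automorphy factor**: for `A = (a b; c d) ∈ Γ₀(M)`,
`χ(d) · e_v(Az) = j(A, z) · e_{vA}(z)`. [folklore] -/
theorem chi_mul_e1Term_smul {v : Fin 2 → ℤ} (hv : IsCoprime (v 0) (v 1)) (hv0 : (M : ℤ) ∣ v 0)
    (s : ℂ) (A : SL(2, ℤ)) (z : ℍ) :
    χ (A 1 1) * e1Term χ s v (A • z) =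
      denom A z * e1Term χ s (v ᵥ* ↑ₘA) z := by
  unfold e1Term
  rw [e1Base_smul hv A z, linear_smul_eq_div hv A z, chi_vecMul_SL_one χ hv0 A, inv_div]
  have hD : denom A z ≠ 0 := denom_ne_zero A z
  have hL : ((v ᵥ* ↑ₘA) 0 : ℂ) * z + (v ᵥ* ↑ₘA) 1
      ≠ 0 := linear_ne_zero_of_isCoprime (isCoprime_vecMul_SL hv A) z
  field_simp

/-- **Weight-one automorphy of `E₁,χ` with character `χ` on `Γ₀(M)`**: for every
`A = (a b; c d) ∈ Γ₀(M)`, every `z ∈ ℍ` and EVERY `s ∈ ℂ` (no convergence needed: the index set is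
permuted by `v ↦ vA`), `χ(d) · E₁,χ(Az, s) = (cz + d) · E₁,χ(z, s)`; for `(d, M) = 1` this is
`E₁,χ(Az, s) = χ̄(d)(cz + d) E₁,χ(z, s)` (Hecke 1927, §2; Miyake §7.2; Shimura 2007, §9).
[folklore] -/
theorem eisensteinOne_smul {A : SL(2, ℤ)} (hA : A ∈ Gamma0 M) (z : ℍ) (s : ℂ) :
    χ (A 1 1) * eisensteinOne χ (A • z) s = denom A z * eisensteinOne χ z s := by
  unfold eisensteinOne
  rw [← tsum_mul_left, ← tsum_mul_left]
  have h1 : ∑' v : {v : Fin 2 → ℤ // IsCoprime (v 0) (v 1) ∧ (M : ℤ) ∣ v 0},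
      χ (A 1 1) * e1Term χ s v (A • z) =
      ∑' v : {v : Fin 2 → ℤ // IsCoprime (v 0) (v 1) ∧ (M : ℤ) ∣ v 0},
        denom A z * e1Term χ s ((gamma0RowsEquiv M hA v : {v : Fin 2 → ℤ //
          IsCoprime (v 0) (v 1) ∧ (M : ℤ) ∣ v 0}) : Fin 2 → ℤ) z :=
    tsum_congr fun v ↦ by rw [coe_gamma0RowsEquiv]; exact chi_mul_e1Term_smul χ v.2.1 v.2.2 s A z
  rw [h1]
  exact (gamma0RowsEquiv M hA).tsum_eq (fun w ↦ denom A z * e1Term χ s (w : Fin 2 → ℤ) z)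

/-- `E₁,χ(z + 1, s) = E₁,χ(z, s)` (`T ∈ Γ₀(M)` has `d = 1`, `j(T, z) = 1`), and more generally for
`Tⁿ`. [folklore] -/
theorem eisensteinOne_T_zpow_smul (n : ℤ) (z : ℍ) (s : ℂ) :
    eisensteinOne χ (ModularGroup.T ^ n • z) s = eisensteinOne χ z s := by
  have e10 : (ModularGroup.T ^ n : SL(2, ℤ)) 1 0 = 0 := by
    rw [ModularGroup.coe_T_zpow]; rfl
  have e11 : (ModularGroup.T ^ n : SL(2, ℤ)) 1 1 = 1 := by
    rw [ModularGroup.coe_T_zpow]; rfl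
  have hT : ModularGroup.T ^ n ∈ Gamma0 M := by
    rw [Gamma0_mem, e10, Int.cast_zero]
  have h := eisensteinOne_smul χ hT z s
  simp only [ModularGroup.denom_apply, e10, e11, Int.cast_zero, zero_mul, zero_add, Int.cast_one,
    map_one, one_mul] at h
  exact h

/-! ### The summand through a matrix with the given bottom row -/

/-- For `γ ∈ SL(2, ℤ)` with bottom row `v = (c, d)`: `Im z/|cz+d|² = Im(γ z)`. [folklore] -/
theorem e1Base_eq_im_smul {v : Fin 2 → ℤ} {γ : SL(2, ℤ)} (h0 : γ 1 0 = v 0) (h1 : γ 1 1 = v 1)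
    (z : ℍ) : e1Base v z = (γ • z).im := by
  rw [ModularGroup.im_smul_eq_div_normSq, Complex.normSq_eq_norm_sq, e1Base, denom]
  simp [← h0, ← h1]

/-- **The summand as `χ(d) j(γ_v, z)⁻¹ (Im γ_v z)ˢ`** for any `γ_v ∈ SL(2, ℤ)` with bottom row
`v = (c, d)` — the form in which the series enters the Rankin–Selberg unfolding
(`Gamma0RankinSelbergUnfolding`, `…Signed`). [folklore] -/
theorem e1Term_eq_of_row {v : Fin 2 → ℤ} {γ : SL(2, ℤ)} (h0 : γ 1 0 = v 0) (h1 : γ 1 1 = v 1)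
    (s : ℂ) (z : ℍ) :
    e1Term χ s v z = χ (v 1) * (denom γ z)⁻¹ * (((γ • z).im : ℝ) : ℂ) ^ s := by
  rw [e1Term, e1Base_eq_im_smul h0 h1, denom]
  simp [← h0, ← h1]

/-! ### Continuity in `z` -/

/-- Each summand is continuous in `z`. [folklore] -/
theorem continuous_e1Term (s : ℂ) {v : Fin 2 → ℤ} (hv : IsCoprime (v 0) (v 1)) :
    Continuous fun z : ℍ => e1Term χ s v z := by
  unfold e1Term e1Base
  have hlin : Continuous fun z : ℍ => (v 0 : ℂ) * z + v 1 :=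
    (continuous_const.mul UpperHalfPlane.continuous_coe).add continuous_const
  have hb : Continuous fun z : ℍ => (((z.im / ‖(v 0 : ℂ) * z + v 1‖ ^ 2 : ℝ)) : ℂ) := by
    refine Complex.continuous_ofReal.comp
      (UpperHalfPlane.continuous_im.div (hlin.norm.pow 2) fun z => ?_)
    exact (pow_pos (norm_pos_iff.mpr (linear_ne_zero_of_isCoprime hv z)) 2).ne'
  refine continuous_iff_continuousAt.mpr fun z => ?_
  refine ((continuousAt_const.mul ((hlin.continuousAt).inv₀ (linear_ne_zero_of_isCoprime hv z))).mul
    ((continuousAt_cpow_const (Or.inl ?_)).comp hb.continuousAt))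
  rw [Complex.ofReal_re]
  exact e1Base_pos hv z

/-- On a vertical box `|Re w| ≤ A`, `B ≤ Im w ≤ Y` the terms are bounded by
`Y^σ r(A, B)^{-(1+2σ)} ‖v‖^{-(1+2σ)}` (`σ = Re s ≥ 0`). [folklore] -/
theorem norm_e1Term_le_of_mem_strip {s : ℂ} (hs : 0 ≤ s.re) {A B Y : ℝ} (hB : 0 < B) {w : ℍ}
    (hw : w ∈ verticalStrip A B) (hY : w.im ≤ Y) {v : Fin 2 → ℤ} (hv : IsCoprime (v 0) (v 1)) :
    ‖e1Term χ s v w‖ ≤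
      Y ^ s.re * (r ⟨⟨A, B⟩, hB⟩ ^ (-(1 + 2 * s.re)) * ‖v‖ ^ (-(1 + 2 * s.re))) := by
  refine (norm_e1Term_le_majorant χ hv (by linarith) w).trans ?_
  have h1 : w.im ^ s.re ≤ Y ^ s.re := Real.rpow_le_rpow w.im_pos.le hY hs
  have h2 : r w ^ (-(1 + 2 * s.re)) ≤ r ⟨⟨A, B⟩, hB⟩ ^ (-(1 + 2 * s.re)) :=
    Real.rpow_le_rpow_of_nonpos (r_pos _) (r_lower_bound_on_verticalStrip w hB hw) (by linarith)
  have h3 : 0 ≤ ‖v‖ ^ (-(1 + 2 * s.re)) := Real.rpow_nonneg (norm_nonneg _) _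
  have h4 : 0 ≤ r ⟨⟨A, B⟩, hB⟩ ^ (-(1 + 2 * s.re)) := Real.rpow_nonneg (r_pos _).le _
  exact mul_le_mul h1 (mul_le_mul_of_nonneg_right h2 h3)
    (mul_nonneg (Real.rpow_nonneg (r_pos _).le _) h3) (Real.rpow_nonneg (by linarith [w.im_pos]) _)

/-- **Continuity of `z ↦ E₁,χ(z, s)` for `Re s > 1/2`** (locally uniform convergence on vertical
boxes). [folklore] -/
theorem continuous_eisensteinOne {s : ℂ} (hs : 1 / 2 < s.re) :
    Continuous fun z : ℍ => eisensteinOne χ z s := by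
  unfold eisensteinOne
  refine continuous_iff_continuousAt.mpr fun z₀ => ?_
  set A : ℝ := |z₀.re| + 1
  set B : ℝ := z₀.im / 2 with hBdef
  have hB : 0 < B := by rw [hBdef]; linarith [z₀.im_pos]
  set V : Set ℍ := {w : ℍ | |w.re| < A ∧ B < w.im ∧ w.im < 2 * z₀.im} with hV
  have hVo : IsOpen V := by
    have h1 : Continuous fun w : ℍ => |w.re| :=
      (Complex.continuous_re.comp UpperHalfPlane.continuous_coe).abs
    have h2 : Continuous fun w : ℍ => w.im := UpperHalfPlane.continuous_im
    exact (isOpen_lt h1 continuous_const).inter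
      ((isOpen_lt continuous_const h2).inter (isOpen_lt h2 continuous_const))
  have hz₀ : z₀ ∈ V := ⟨by simp [A], by rw [hBdef]; linarith [z₀.im_pos], by linarith [z₀.im_pos]⟩
  have hVS : ∀ w ∈ V, w ∈ verticalStrip A B ∧ w.im ≤ 2 * z₀.im := fun w hw =>
    ⟨⟨hw.1.le, hw.2.1.le⟩, hw.2.2.le⟩
  have hcont : ContinuousOn (fun w : ℍ =>
      ∑' v : {v : Fin 2 → ℤ // IsCoprime (v 0) (v 1) ∧ (M : ℤ) ∣ v 0}, e1Term χ s v w) V := by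
    refine continuousOn_tsum
      (u := fun v : {v : Fin 2 → ℤ // IsCoprime (v 0) (v 1) ∧ (M : ℤ) ∣ v 0} =>
        (2 * z₀.im) ^ s.re *
          (r ⟨⟨A, B⟩, hB⟩ ^ (-(1 + 2 * s.re)) * ‖(v : Fin 2 → ℤ)‖ ^ (-(1 + 2 * s.re))))
      (fun v => (continuous_e1Term χ s v.2.1).continuousOn)
      (((summable_majorant_rows hs).mul_left
        ((2 * z₀.im) ^ s.re * r ⟨⟨A, B⟩, hB⟩ ^ (-(1 + 2 * s.re)))).congr fun v => by ring) ?_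
    intro v w hw
    exact norm_e1Term_le_of_mem_strip χ (by linarith) hB (hVS w hw).1 (hVS w hw).2 v.2.1
  exact hcont.continuousAt (hVo.mem_nhds hz₀)

/-! ### Holomorphy in `s` on `Re s > 1/2` -/

/-- Each summand is an entire function of `s`. [folklore] -/
theorem differentiable_e1Term {v : Fin 2 → ℤ} (hv : IsCoprime (v 0) (v 1)) (z : ℍ) :
    Differentiable ℂ fun s : ℂ => e1Term χ s v z := by
  intro s
  unfold e1Term
  refine (differentiableAt_const _).mul ?_
  have hb : ((e1Base v z : ℝ) : ℂ) ≠ 0 := by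
    exact_mod_cast (e1Base_pos hv z).ne'
  exact differentiableAt_id.const_cpow (Or.inl hb)

/-- On `a ≤ Re s ≤ b` the summand is bounded by the sum of the majorants at `a` and at `b`
(`x^t ≤ x^a + x^b` for `x > 0`, `a ≤ t ≤ b`). [folklore] -/
theorem norm_e1Term_le_add {v : Fin 2 → ℤ} (hv : IsCoprime (v 0) (v 1)) {a b : ℝ} {s : ℂ}
    (ha : a ≤ s.re) (hb : s.re ≤ b) (z : ℍ) :
    ‖e1Term χ s v z‖ ≤ ‖(v 0 : ℂ) * z + v 1‖⁻¹ * (e1Base v z) ^ a +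
      ‖(v 0 : ℂ) * z + v 1‖⁻¹ * (e1Base v z) ^ b := by
  refine (norm_e1Term_le χ hv s z).trans ?_
  rw [← mul_add]
  refine mul_le_mul_of_nonneg_left ?_ (by positivity)
  have hx := e1Base_pos hv z
  rcases le_or_gt (e1Base v z) 1 with h1 | h1
  · have : e1Base v z ^ s.re ≤ e1Base v z ^ a := Real.rpow_le_rpow_of_exponent_ge hx h1 ha
    linarith [Real.rpow_nonneg hx.le b]
  · have : e1Base v z ^ s.re ≤ e1Base v z ^ b := Real.rpow_le_rpow_of_exponent_le h1.le hb
    linarith [Real.rpow_nonneg hx.le a]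

/-- **`s ↦ E₁,χ(z, s)` is holomorphic on `Re s > 1/2`** (the series of entire functions converges
locally uniformly: on `a < Re s < b`, `1/2 < a`, it is dominated by the sum of the absolutely
convergent majorants at `a` and `b`). [folklore] -/
theorem differentiableOn_eisensteinOne (z : ℍ) :
    DifferentiableOn ℂ (fun s : ℂ => eisensteinOne χ z s) {s : ℂ | 1 / 2 < s.re} := by
  intro s₀ hs₀
  simp only [Set.mem_setOf_eq] at hs₀
  -- an open vertical strip `a < Re s < b` about `s₀`
  set a : ℝ := (1 / 2 + s₀.re) / 2 with ha
  set b : ℝ := s₀.re + 1 with hb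
  have ha' : 1 / 2 < a := by rw [ha]; linarith
  have hb' : 1 / 2 < b := by rw [hb]; linarith
  set U : Set ℂ := {s : ℂ | a < s.re ∧ s.re < b} with hU
  have hUo : IsOpen U :=
    (isOpen_lt continuous_const Complex.continuous_re).inter
      (isOpen_lt Complex.continuous_re continuous_const)
  have hs₀U : s₀ ∈ U := ⟨by rw [ha]; linarith, by rw [hb]; linarith⟩
  have hdiff : DifferentiableOn ℂ (fun s : ℂ => eisensteinOne χ z s) U := by
    unfold eisensteinOne
    refine differentiableOn_tsum_of_summable_norm
      (u := fun v : {v : Fin 2 → ℤ // IsCoprime (v 0) (v 1) ∧ (M : ℤ) ∣ v 0} =>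
        ‖((v : Fin 2 → ℤ) 0 : ℂ) * z + (v : Fin 2 → ℤ) 1‖⁻¹ * (e1Base v z) ^ a +
          ‖((v : Fin 2 → ℤ) 0 : ℂ) * z + (v : Fin 2 → ℤ) 1‖⁻¹ * (e1Base v z) ^ b)
      ?_ (fun v _ _ ↦ (differentiable_e1Term χ v.2.1 z).differentiableAt.differentiableWithinAt)
      hUo (fun v s hs ↦ norm_e1Term_le_add χ v.2.1 hs.1.le hs.2.le z)
    -- summability of the two majorants
    have key : ∀ {c : ℝ}, 1 / 2 < c → Summable fun v : {v : Fin 2 → ℤ //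
        IsCoprime (v 0) (v 1) ∧ (M : ℤ) ∣ v 0} =>
        ‖((v : Fin 2 → ℤ) 0 : ℂ) * z + (v : Fin 2 → ℤ) 1‖⁻¹ * (e1Base v z) ^ c := by
      intro c hc
      refine Summable.of_nonneg_of_le
        (fun v ↦ mul_nonneg (inv_nonneg.mpr (norm_nonneg _))
          (Real.rpow_nonneg (e1Base_pos v.2.1 z).le _)) (fun v ↦ ?_)
        ((summable_majorant_rows hc).mul_left (z.im ^ c * r z ^ (-(1 + 2 * c))))
      rw [inv_mul_e1Base_rpow v.2.1, mul_assoc]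
      refine mul_le_mul_of_nonneg_left ?_ (by positivity)
      exact summand_bound z (k := 1 + 2 * c) (by linarith) v
    exact (key ha').add (key hb')
  exact (hdiff.differentiableAt (hUo.mem_nhds hs₀U)).differentiableWithinAt

/-- `s ↦ E₁,χ(z, s)` is complex differentiable at every `s` with `Re s > 1/2`. [folklore] -/
theorem differentiableAt_eisensteinOne (z : ℍ) {s : ℂ} (hs : 1 / 2 < s.re) :
    DifferentiableAt ℂ (fun s : ℂ => eisensteinOne χ z s) s :=
  (differentiableOn_eisensteinOne χ z).differentiableAt
    ((isOpen_lt continuous_const Complex.continuous_re).mem_nhds hs)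

end Series

end Literature.NumberTheory.EllipticCurves.ModularForms
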